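import Summits.BirchSwinnertonDyer.BirchSwinnertonDyer.Theorems.KatoDescentPotSupersingularCartanMuRoadRealDoors
import Summits.BirchSwinnertonDyer.BirchSwinnertonDyer.Theorems.KatoDescentPotSupersingularModThreeSplitCartanCertificate
import Summits.BirchSwinnertonDyer.BirchSwinnertonDyer.Theorems.KatoDescentTamePotSupersingularTameUpperUnitTwistRecordToolsConductor
import Summits.BirchSwinnertonDyer.BirchSwinnertonDyer.Theorems.KatoDescentTamePotSupersingularTameUpperUnitTwistRecordTools
import Summits.BirchSwinnertonDyer.BirchSwinnertonDyer.Theorems.Rank2ObservatoryTateDeepCert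
import Summits.BirchSwinnertonDyer.BirchSwinnertonDyer.Theorems.Rank2ObservatoryTateStep2Cert
import Summits.BirchSwinnertonDyer.BirchSwinnertonDyer.Theorems.Rank1ResidualIntModelReduction
import Summits.BirchSwinnertonDyer.Rank1Residual.Supersingular.CountPointsFast
import Summits.BirchSwinnertonDyer.Rank1Residual.Supersingular.IntModelMinimalityKrausTwoMore
import Summits.BirchSwinnertonDyer.Rank1Residual.Additive.X4ThreeResCertKernel
import Summits.BirchSwinnertonDyer.Rank1Residual.X11b.CertificateCheckBridge
import Summits.BirchSwinnertonDyer.Rank1Residual.X11b.ChaPairsMinimality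
import Literature.NumberTheory.EllipticCurves.ModThreeImageCubeDiscriminantProofs
import HarnessLib

/-!
# Route `KatoDescentPotSupersingular` (rung K9, sub-rung B5 = O6 wild `p = 3`, cell `bsd-potss`): the 25 RESIDUE ROWS of the Conj-A crux
# `WildCoatesSujathaResidue` (item 19942; U₀-ns node 19189 → parent 19197) on the CARTAN μ-ROAD — kernel row certificates + per-row
# (A) / U₀ records from ONE classical `μ`-hypothesis (part 10: 218592l1, 332073f1)
# (seat `bsd-potss-k9-c4` g18; `--supports stmt-BirchSwinnertonDyer-19197 --as helper`)

HONEST FRAMING. THEOREMS ONLY (no definition, no named fact, no `sorry`); PER ROW — NOT a class theorem; nothing is booked; items 19942 /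
19189 / 19197 stay OPEN at class level (their class-wide open input is the zeta crux 24327 `WildKatoZetaIndivisible`; the Cartan μ-road is a
SECOND, lemma-level road, plan g28 R263); Coates–Sujatha's (A), Conjecture A and BSD are proved for NO curve here.  The 25 rows are k9-c4
g17's census residue (19 double-carrier `q = 3` + 4 multi-carrier + 2 additive-carrier-5 rows: no single-Tamagawa-carrier unit-twist road).
ROAD (conjA-anchor g11 N3/N4 p620354/p620850 ∘ this seat's doors `CartanMuRoadRealDoors`, p626162): on a `3Ns` / `3Nn` row, statement (A)
at `(E, 3)` — and then U₀ `MissingUpperBoundAt E 3` by `WildFineSelmerSupersingularCMAnchor.missingUpperBoundAt_wild_of_conjA` (Kato A161-fine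
+ GZK + modularity) — follows from the NAMED FACTS Coates–Sujatha 2005 Thm. 3.4 (`hCS`), Ferrero–Washington (`hFW`) [+ Iwasawa's growth
theorem `hI` on `3Nn` rows] and ONE classical hypothesis: Iwasawa's `μ = 0` for the cyclotomic `ℤ_3`-extension of the MAXIMAL REAL SUBFIELD
`ℚ(E[3])⁺` (the fixed field of a complex conjugation `c` restricted to `ℚ(E[3])`; `= ℚ(P)` for a real `3`-torsion point `P`, of degree `4`
on `3Ns` rows and `8` on `3Nn` rows) — the involution binders of the road being DISCHARGED by `c` (`det ρ̄₃(c) = −1`).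
IN THE KERNEL per row: `Δ ≠ 0`; global minimality (Kraus); `E[3]` irreducible (Frobenius witness); `Addv`/`ClassO6 E 3` (integer-model
Tate certificate at `3`, k8t-c4 g15's pattern); on `3Ns` rows the IMAGE (`HasSplitCartanNormalizerModPImage E 3` from a quadratic factor
of `Ψ₃`, this seat's tool `ModThreeSplitCartanCertificate`, p626641); on all Cartan rows `Δ = d³ ⟹ ρ̄₃ not onto`.  DISPLAYED per row:
the named facts; Cremona's `r_an = 0` (`hr`); on `3Nn` rows the image EQUALITY `HasModPImageEqNonsplitCartanNormalizer E 3` (LMFDB; its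
kernel certificate would need the irreducibility of `Ψ₃` over `ℚ` — not attempted); the `μ`-hypothesis `hμ`.  The two `GL₂(𝔽₃)`-image
(9-deficient) residue rows `388800ho1/ii1` have NO Cartan road; only their row certificates are filed.  Data: this seat's `data/rows25.json`
(generator `work/rows/gen18.py`, every kernel-asserted value re-checked in exact arithmetic; Tate translation by k8t-c4 g15's `tate.py`).

References: [CoatesSujatha2005] Thm. 3.4; [Kato2004Asterisque] Thm. 12.5 (3), 14.5 (3); [Serre1972] §2.2, §5.2, §5.3; [Cremona1997] §3.8;
[Washington1997] §7.5, §13.1; [Mazur1978] §6; [SilvermanAEC2009] VII.1, VII.5; [SilvermanATAEC1994] IV.9; [Kraus1989]; [Cremona2006] Table 1.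
-/

set_option autoImplicit false
set_option linter.dupNamespace false

noncomputable section

open scoped Classical NumberField
open Polynomial WeierstrassCurve NumberField IsDedekindDomain IsDedekindDomain.HeightOneSpectrum Rat.HeightOneSpectrum Field IntermediateField
  Literature.NumberTheory.DiophantineGeometry Literature.NumberTheory.EllipticCurves
  Literature.NumberTheory.EllipticCurves.ModularForms Literature.NumberTheory.EllipticCurves.Rank1Residual
  Literature.NumberTheory.EllipticCurves.Rank1Residual.Typed Literature.NumberTheory.Automorphic
  Literature.NumberTheory.EllipticCurves.Rank1Residual.X11RankOneCertificates
  Literature.NumberTheory.GaloisRepresentations Literature.NumberTheory.SerreUniformity Literature.NumberTheory.IwasawaTheory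
  Summit.BirchSwinnertonDyer.BirchSwinnertonDyer.Rank1Residual.IntModel
  Summit.BirchSwinnertonDyer.Rank1Residual Summit.BirchSwinnertonDyer.Rank1Residual.Additive
  Summit.BirchSwinnertonDyer.Rank1Residual.X11b Summit.BirchSwinnertonDyer.Rank1Residual.Supersingular
  Summit.BirchSwinnertonDyer.BirchSwinnertonDyer.Rank2Observatory.RootNumber
  Summit.BirchSwinnertonDyer.BirchSwinnertonDyer.Theorems
  Summit.BirchSwinnertonDyer.BirchSwinnertonDyer.Theorems.TameUpperUnitTwistRecords

namespace Summit.BirchSwinnertonDyer.BirchSwinnertonDyer.Theorems.WildUpperUnitTwistRecords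

/-! ### `218592l1` @ `p = 3` — `N = 218592 = 2^5·3^3·11·23`; Cremona: `r_an = 0` (displayed where used); O6 WILD at `3` (`f₃ = 3`, Kodaira `IV*`);
mod-`3` image: `3Nn` (normaliser of a non-split Cartan; LMFDB) — `Δ = d³` certified below (⟹ `ρ̄₃` not onto), the EQUALITY with `C_ns⁺(3)` displayed; a RESIDUE row of `WildCoatesSujathaResidue` (19942): no single-Tamagawa-carrier road (k9-c4 g17 census v2). -/

/-- `[0, 0, 0, 11637, (-379890)]` (Cremona's minimal model of `218592l1`, `N = 218592`) is an elliptic curve: `|Δ| = 2^9·3^9·11^3·23^3 ≠ 0`.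
[cite: Cremona2006, Table 1 (Cremona label 218592l1)] -/
theorem isElliptic_g218592l1 : (⟨0, 0, 0, 11637, (-379890)⟩ : WeierstrassCurve ℚ).IsElliptic :=
  isElliptic_of_discOf_ne_zero 0 0 0 11637 (-379890) (by decide +kernel)

/-- `[0, 0, 0, 11637, (-379890)]` (Cremona's minimal model of `218592l1`) is globally minimal: `|Δ| = 2^9·3^9·11^3·23^3` kernel-checked, Kraus' criterion prime
by prime. [cite: SilvermanAEC2009, VII.1 Remark 1.1] [cite: Kraus1989, Prop. 1 and Prop. 2] [cite: Cremona2006, Table 1 (Cremona label 218592l1)] -/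
theorem isGloballyMinimal_g218592l1 : (⟨0, 0, 0, 11637, (-379890)⟩ : WeierstrassCurve ℚ).IsGloballyMinimal :=
  isGloballyMinimal_of_krausCriterion₃_factored 0 0 0 11637 (-379890)
    [(2, 9), (3, 9), (11, 3), (23, 3)] (by decide +kernel)
    (by intro qe hqe; simp only [List.mem_cons, List.not_mem_nil, or_false] at hqe
        rcases hqe with rfl | rfl | rfl | rfl <;> norm_num)
    (by set_option synthInstance.maxSize 2000 in decide +kernel)

/-- **`E[3]` IRREDUCIBLE for `E = 218592l1`** (kernel; Frobenius witness `ℓ = 5`: `#Ẽ(𝔽_{5}) = 2`, `a_{5} = 4`, `X² − (4)X + 5`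
has no root mod `3`; `IntModel.hasIrreducibleModPGaloisRep_of_intModel_of_noroot`). [cite: Mazur1978, §6 Prop. 6.3 (1) (p. 153)]
[cite: IrelandRosen1990, Prop. 5.1.2 and §8.1] [cite: Cremona2006, Table 1 (Cremona label 218592l1)] -/
theorem irr_g218592l1_3 : (⟨0, 0, 0, 11637, (-379890)⟩ : WeierstrassCurve ℚ).HasIrreducibleModPGaloisRep 3 := by
  have hnr : ∀ t : ZMod 3, t ^ 2 - ((((5 : ℕ) : ℤ) + 1 - ((2 : ℕ) : ℤ) : ℤ) : ZMod 3) * t + ((5 : ℕ) : ZMod 3) ≠ 0 := by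
    decide
  haveI := isElliptic_g218592l1
  haveI := isGloballyMinimal_g218592l1
  haveI : Fact (Nat.Prime 5) := ⟨by norm_num⟩
  have hI : integralModelInt (⟨0, 0, 0, 11637, (-379890)⟩ : WeierstrassCurve ℚ) = (⟨0, 0, 0, 11637, (-379890)⟩ : WeierstrassCurve ℤ) :=
    integralModelInt_eq_of_map_eq _ (map_mk_int 0 0 0 11637 (-379890))
  have hc : Nat.card (((((⟨0, 0, 0, 11637, (-379890)⟩ : WeierstrassCurve ℤ))).map (Int.castRingHom (ZMod 5))).toAffine.Point) = 2 := by
    have h := natCard_point_eq_countPoints 0 0 0 11637 (-379890) 5 (by norm_num) (by decide +kernel)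
    have h' : countPoints [0, 0, 0, 11637, (-379890)] 5 = 2 := countPoints_eq_of_fast (by decide +kernel)
    exact_mod_cast h.trans h'
  exact hasIrreducibleModPGaloisRep_of_intModel_of_noroot hI 3 5 (by norm_num) (by decide +kernel) hc hnr

/-- **`218592l1` is ADDITIVE at `3`** (kernel: `3 ∣ Δ`, `3 ∣ c₄` on the minimal model; `Additive.addv_of_intModel`).
[cite: SilvermanAEC2009, VII.5 Prop. 5.1 (c)] [cite: Cremona2006, Table 1 (Cremona label 218592l1)] -/
theorem addv_g218592l1_3 : haveI := isElliptic_g218592l1; haveI := isGloballyMinimal_g218592l1; Addv (⟨0, 0, 0, 11637, (-379890)⟩ : WeierstrassCurve ℚ) 3 := by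
  haveI := isElliptic_g218592l1
  haveI := isGloballyMinimal_g218592l1
  have hI : integralModelInt (⟨0, 0, 0, 11637, (-379890)⟩ : WeierstrassCurve ℚ) = (⟨0, 0, 0, 11637, (-379890)⟩ : WeierstrassCurve ℤ) :=
    integralModelInt_eq_of_map_eq _ (map_mk_int 0 0 0 11637 (-379890))
  exact Additive.addv_of_intModel hI 3 (by decide +kernel) (by decide +kernel)

/-- **`218592l1` lies on the class O6 at `3`** — `ClassO6 E 3 = (3 ≠ 2) ∧ Addv E 3 ∧ SubW E 3`, `SubW E 3 = ¬ PotMult ∧ f₃ ≠ 2` (WILD):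
kernel — `ord₃ j ≥ 0` (`padicValRat_j_nonneg_of_intModel`, `a = 4`, `b = 9`) and `f₃ = 3` by Ogg's formula on the rank-2
observatory's `DeepCert` integer-model Tate certificate (Kodaira `IV*` at `3`, `decide`; k8t-c4 g15's pattern, translation by its `tate.py`).
[cite: SilvermanATAEC1994, IV.9.4, IV.10.4, IV.11.1] [cite: Cremona2006, Table 1 (Cremona label 218592l1)] -/
theorem classO6_g218592l1_3 : haveI := isElliptic_g218592l1; haveI := isGloballyMinimal_g218592l1;
    ClassO6 (⟨0, 0, 0, 11637, (-379890)⟩ : WeierstrassCurve ℚ) 3 := by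
  haveI := isElliptic_g218592l1
  haveI := isGloballyMinimal_g218592l1
  have hI : integralModelInt (⟨0, 0, 0, 11637, (-379890)⟩ : WeierstrassCurve ℚ) = (⟨0, 0, 0, 11637, (-379890)⟩ : WeierstrassCurve ℤ) :=
    integralModelInt_eq_of_map_eq _ (map_mk_int 0 0 0 11637 (-379890))
  have hb : (⟨0, 0, 0, 11637, (-379890)⟩ : WeierstrassCurve ℤ).baseChange ℚ = (⟨0, 0, 0, 11637, (-379890)⟩ : WeierstrassCurve ℚ) := by
    ext <;> norm_num [WeierstrassCurve.baseChange, WeierstrassCurve.map]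
  have hGM : ((⟨0, 0, 0, 11637, (-379890)⟩ : WeierstrassCurve ℤ).baseChange ℚ).IsGloballyMinimal := hb ▸ isGloballyMinimal_g218592l1
  have hf : (⟨0, 0, 0, 11637, (-379890)⟩ : WeierstrassCurve ℚ).conductorExponent (natPlace 3) = 3 := by
    have h := Rank2Observatory.Tate.DeepCert.conductorExponent_int_eq (W₀ := (⟨0, 0, 0, 11637, (-379890)⟩ : WeierstrassCurve ℤ)) (c := ⟨3, 0, 0, 0, 9, 8, 0⟩) (natPlace 3)
      (natGenerator_natPlace (by norm_num)) hGM (by decide +kernel)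
    rw [hb] at h
    exact h.trans (by decide)
  refine ⟨by decide, addv_g218592l1_3, ?_, ?_⟩
  · exact not_lt.mpr (padicValRat_j_nonneg_of_intModel hI 3 (a := 4) (b := 9) (by decide +kernel) (by decide +kernel) (by norm_num))
  · show ¬ ((⟨0, 0, 0, 11637, (-379890)⟩ : WeierstrassCurve ℚ).conductorExponent (placeOf 3) = 2)
    rw [← natPlace_eq_placeOf, hf]; decide

/-- `Δ(218592l1) = (-54648)³` — a CUBE (kernel, `norm_num`). [cite: Serre1972, §5.3] [cite: Cremona2006, Table 1 (Cremona label 218592l1)] -/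
theorem Δ_eq_cube_g218592l1 : (⟨0, 0, 0, 11637, (-379890)⟩ : WeierstrassCurve ℚ).Δ = (((-54648) : ℚ)) ^ 3 := by
  norm_num [WeierstrassCurve.Δ, WeierstrassCurve.b₂, WeierstrassCurve.b₄, WeierstrassCurve.b₆, WeierstrassCurve.b₈]

/-- **`ρ̄_{218592l1,3}` is NOT surjective** (kernel): `Δ` is a cube, tree THEOREM `ModThreeImage.not_hasSurjectiveModNGaloisRep_three_of_Δ_eq_cube`
(Serre 1972 §5.3: `ℚ(E[3]) ⊇ ℚ(μ₃, ∛Δ)`). [cite: Serre1972, §5.3] [cite: Cremona2006, Table 1 (Cremona label 218592l1)] -/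
theorem notSurjThree_g218592l1 : ¬ (⟨0, 0, 0, 11637, (-379890)⟩ : WeierstrassCurve ℚ).HasSurjectiveModNGaloisRep 3 := by
  haveI := isElliptic_g218592l1
  exact ModThreeImage.not_hasSurjectiveModNGaloisRep_three_of_Δ_eq_cube (⟨0, 0, 0, 11637, (-379890)⟩ : WeierstrassCurve ℚ) (d := ((-54648) : ℚ)) Δ_eq_cube_g218592l1

/-- **(A) AT `(218592l1, 3)` FROM ONE CLASSICAL `μ`-HYPOTHESIS, image `3Nn` DISPLAYED** — the conclusion of the K9 crux
`WildCoatesSujathaResidue` (item 19942) AT THIS ROW, from Coates–Sujatha Thm. 3.4 (`hCS`), Iwasawa's growth theorem (`hI`), Ferrero–Washington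
(`hFW`) — named facts —, the image EQUALITY `HasModPImageEqNonsplitCartanNormalizer E 3` (`himg`, LMFDB `3Nn`; only `ρ̄₃` not onto is
certified here, `notSurjThree_g218592l1`) and `μ = 0` for every cyclotomic `ℤ_3`-extension of the maximal real subfield `ℚ(E[3])⁺ = ℚ(P)`
(degree `8`), `c` any complex conjugation. CONDITIONAL; nothing booked; (A)/BSD proved for no curve.
[cite: CoatesSujatha2005, Thm. 3.4 (§3)] [cite: Serre1972, §2.2, §5.2 (iv)] [cite: Washington1997, §13.1] [cite: Cremona2006, Table 1 (Cremona label 218592l1)] -/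
theorem conjA_g218592l1_3
    (hCS : CoatesSujatha2005.thm34_fineSelmerDual_moduleFinite_of_classicalMuVanishes_divisionField)
    (hI : iwasawa1959_classNumberPExp_growth) (hFW : ferreroWashington1979_classicalMuVanishes)
    {W : WeierstrassCurve ℚ} [W.IsElliptic] (hWeq : W = (⟨0, 0, 0, 11637, (-379890)⟩ : WeierstrassCurve ℚ)) (himg : HasModPImageEqNonsplitCartanNormalizer W 3)
    {c : absoluteGaloisGroup ℚ} (hc : IsComplexConjugation (Rat.castHom ℝ) c)
    (hμ : ∀ κE : ZpExtension ↥(fixedField (Subgroup.zpowers (absRestrictNormalHom (W.divisionField 3) c))) 3,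
      κE.IsCyclotomic → ClassicalMuVanishes κE)
    (κ : ZpExtension ℚ 3) (hκ : κ.IsCyclotomic) :
    ∃ (γ : absoluteGaloisGroup ℚ) (Df : W.FineSelmerDualData κ γ),
      Module.Finite ℤ_[3] (RestrictScalars ℤ_[3] (IwasawaAlgebra 3) Df.X) := by
  subst hWeq
  exact CartanMuRoadRealDoors.conjA_three_of_hasModPImageEqNonsplitCartanNormalizer_of_realMu' _ hCS hI hFW himg hc hμ κ hκ

/-- **RECORD — U₀ `ord₃ #Ш(E) ≤ ord₃ #Ш_an(E)` for `E = 218592l1` (a RESIDUE row of K9 items 19189 / 19197) FROM ONE CLASSICAL `μ`-HYPOTHESIS,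
image `3Nn` DISPLAYED**: named facts `hKatoA hGZK hmod hCS hI hFW`; DISPLAYED: Cremona's `r_an = 0` (`hr`), the image equality (`himg`),
`μ = 0` for the cyclotomic `ℤ_3`-extension of the maximal real subfield of `ℚ(E[3])` (`hμ`). KERNEL: elliptic + minimal, `ClassO6 E 3`,
`E[3]` irreducible. Per row; nothing booked; BSD proved for no curve. [cite: Kato2004Asterisque, Thm. 14.5 (3) (p. 236)]
[cite: CoatesSujatha2005, Thm. 3.4 (§3)] [cite: Washington1997, §13.1] [cite: Cremona2006, Table 1 (Cremona label 218592l1)] -/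
theorem missingUpperBoundAt_g218592l1_3
    (hKatoA : Kato2004.rankZero_padicValNat_sha_add_padicValNat_tamagawa_le_of_additive_potGood_of_irreducible_of_fineSelmerDual_fg)
    (hGZK : rank_eq_analyticRank_of_analyticRank_le_one) (hmod : hasEntireLFunction_rat)
    (hCS : CoatesSujatha2005.thm34_fineSelmerDual_moduleFinite_of_classicalMuVanishes_divisionField)
    (hI : iwasawa1959_classNumberPExp_growth) (hFW : ferreroWashington1979_classicalMuVanishes)
    {W : WeierstrassCurve ℚ} [W.IsElliptic] [W.IsGloballyMinimal] (hWeq : W = (⟨0, 0, 0, 11637, (-379890)⟩ : WeierstrassCurve ℚ)) (hr : W.analyticRank = 0)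
    (himg : HasModPImageEqNonsplitCartanNormalizer W 3)
    {c : absoluteGaloisGroup ℚ} (hc : IsComplexConjugation (Rat.castHom ℝ) c)
    (hμ : ∀ κE : ZpExtension ↥(fixedField (Subgroup.zpowers (absRestrictNormalHom (W.divisionField 3) c))) 3,
      κE.IsCyclotomic → ClassicalMuVanishes κE) :
    MissingUpperBoundAt W 3 := by
  subst hWeq
  haveI : Fact (Nat.Prime 3) := ⟨Nat.prime_three⟩
  exact CartanMuRoadRealDoors.missingUpperBoundAt_three_of_hasModPImageEqNonsplitCartanNormalizer_of_realMu' _ hKatoA hGZK hmod hCS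
    hI hFW hr classO6_g218592l1_3 irr_g218592l1_3 himg hc hμ

/-! ### `332073f1` @ `p = 3` — `N = 332073 = 3^3·7^2·251`; Cremona: `r_an = 0` (displayed where used); O6 WILD at `3` (`f₃ = 3`, Kodaira `IV*`);
mod-`3` image: `3Nn` (normaliser of a non-split Cartan; LMFDB) — `Δ = d³` certified below (⟹ `ρ̄₃` not onto), the EQUALITY with `C_ns⁺(3)` displayed; a RESIDUE row of `WildCoatesSujathaResidue` (19942): no single-Tamagawa-carrier road (k9-c4 g17 census v2). -/

/-- `[1, (-1), 0, (-933), (-497008)]` (Cremona's minimal model of `332073f1`, `N = 332073`) is an elliptic curve: `|Δ| = 3^9·7^3·251^3 ≠ 0`.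
[cite: Cremona2006, Table 1 (Cremona label 332073f1)] -/
theorem isElliptic_g332073f1 : (⟨1, (-1), 0, (-933), (-497008)⟩ : WeierstrassCurve ℚ).IsElliptic :=
  isElliptic_of_discOf_ne_zero 1 (-1) 0 (-933) (-497008) (by decide +kernel)

/-- `[1, (-1), 0, (-933), (-497008)]` (Cremona's minimal model of `332073f1`) is globally minimal: `|Δ| = 3^9·7^3·251^3` kernel-checked, Kraus' criterion prime
by prime. [cite: SilvermanAEC2009, VII.1 Remark 1.1] [cite: Kraus1989, Prop. 1 and Prop. 2] [cite: Cremona2006, Table 1 (Cremona label 332073f1)] -/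
theorem isGloballyMinimal_g332073f1 : (⟨1, (-1), 0, (-933), (-497008)⟩ : WeierstrassCurve ℚ).IsGloballyMinimal :=
  isGloballyMinimal_of_krausCriterion₃_factored 1 (-1) 0 (-933) (-497008)
    [(3, 9), (7, 3), (251, 3)] (by decide +kernel)
    (by intro qe hqe; simp only [List.mem_cons, List.not_mem_nil, or_false] at hqe
        rcases hqe with rfl | rfl | rfl <;> norm_num)
    (by set_option synthInstance.maxSize 2000 in decide +kernel)

/-- **`E[3]` IRREDUCIBLE for `E = 332073f1`** (kernel; Frobenius witness `ℓ = 11`: `#Ẽ(𝔽_{11}) = 17`, `a_{11} = -5`, `X² − (-5)X + 11`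
has no root mod `3`; `IntModel.hasIrreducibleModPGaloisRep_of_intModel_of_noroot`). [cite: Mazur1978, §6 Prop. 6.3 (1) (p. 153)]
[cite: IrelandRosen1990, Prop. 5.1.2 and §8.1] [cite: Cremona2006, Table 1 (Cremona label 332073f1)] -/
theorem irr_g332073f1_3 : (⟨1, (-1), 0, (-933), (-497008)⟩ : WeierstrassCurve ℚ).HasIrreducibleModPGaloisRep 3 := by
  have hnr : ∀ t : ZMod 3, t ^ 2 - ((((11 : ℕ) : ℤ) + 1 - ((17 : ℕ) : ℤ) : ℤ) : ZMod 3) * t + ((11 : ℕ) : ZMod 3) ≠ 0 := by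
    decide
  haveI := isElliptic_g332073f1
  haveI := isGloballyMinimal_g332073f1
  haveI : Fact (Nat.Prime 11) := ⟨by norm_num⟩
  have hI : integralModelInt (⟨1, (-1), 0, (-933), (-497008)⟩ : WeierstrassCurve ℚ) = (⟨1, (-1), 0, (-933), (-497008)⟩ : WeierstrassCurve ℤ) :=
    integralModelInt_eq_of_map_eq _ (map_mk_int 1 (-1) 0 (-933) (-497008))
  have hc : Nat.card (((((⟨1, (-1), 0, (-933), (-497008)⟩ : WeierstrassCurve ℤ))).map (Int.castRingHom (ZMod 11))).toAffine.Point) = 17 := by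
    have h := natCard_point_eq_countPoints 1 (-1) 0 (-933) (-497008) 11 (by norm_num) (by decide +kernel)
    have h' : countPoints [1, (-1), 0, (-933), (-497008)] 11 = 17 := countPoints_eq_of_fast (by decide +kernel)
    exact_mod_cast h.trans h'
  exact hasIrreducibleModPGaloisRep_of_intModel_of_noroot hI 3 11 (by norm_num) (by decide +kernel) hc hnr

/-- **`332073f1` is ADDITIVE at `3`** (kernel: `3 ∣ Δ`, `3 ∣ c₄` on the minimal model; `Additive.addv_of_intModel`).
[cite: SilvermanAEC2009, VII.5 Prop. 5.1 (c)] [cite: Cremona2006, Table 1 (Cremona label 332073f1)] -/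
theorem addv_g332073f1_3 : haveI := isElliptic_g332073f1; haveI := isGloballyMinimal_g332073f1; Addv (⟨1, (-1), 0, (-933), (-497008)⟩ : WeierstrassCurve ℚ) 3 := by
  haveI := isElliptic_g332073f1
  haveI := isGloballyMinimal_g332073f1
  have hI : integralModelInt (⟨1, (-1), 0, (-933), (-497008)⟩ : WeierstrassCurve ℚ) = (⟨1, (-1), 0, (-933), (-497008)⟩ : WeierstrassCurve ℤ) :=
    integralModelInt_eq_of_map_eq _ (map_mk_int 1 (-1) 0 (-933) (-497008))
  exact Additive.addv_of_intModel hI 3 (by decide +kernel) (by decide +kernel)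

/-- **`332073f1` lies on the class O6 at `3`** — `ClassO6 E 3 = (3 ≠ 2) ∧ Addv E 3 ∧ SubW E 3`, `SubW E 3 = ¬ PotMult ∧ f₃ ≠ 2` (WILD):
kernel — `ord₃ j ≥ 0` (`padicValRat_j_nonneg_of_intModel`, `a = 4`, `b = 9`) and `f₃ = 3` by Ogg's formula on the rank-2
observatory's `DeepCert` integer-model Tate certificate (Kodaira `IV*` at `3`, `decide`; k8t-c4 g15's pattern, translation by its `tate.py`).
[cite: SilvermanATAEC1994, IV.9.4, IV.10.4, IV.11.1] [cite: Cremona2006, Table 1 (Cremona label 332073f1)] -/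
theorem classO6_g332073f1_3 : haveI := isElliptic_g332073f1; haveI := isGloballyMinimal_g332073f1;
    ClassO6 (⟨1, (-1), 0, (-933), (-497008)⟩ : WeierstrassCurve ℚ) 3 := by
  haveI := isElliptic_g332073f1
  haveI := isGloballyMinimal_g332073f1
  have hI : integralModelInt (⟨1, (-1), 0, (-933), (-497008)⟩ : WeierstrassCurve ℚ) = (⟨1, (-1), 0, (-933), (-497008)⟩ : WeierstrassCurve ℤ) :=
    integralModelInt_eq_of_map_eq _ (map_mk_int 1 (-1) 0 (-933) (-497008))
  have hb : (⟨1, (-1), 0, (-933), (-497008)⟩ : WeierstrassCurve ℤ).baseChange ℚ = (⟨1, (-1), 0, (-933), (-497008)⟩ : WeierstrassCurve ℚ) := by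
    ext <;> norm_num [WeierstrassCurve.baseChange, WeierstrassCurve.map]
  have hGM : ((⟨1, (-1), 0, (-933), (-497008)⟩ : WeierstrassCurve ℤ).baseChange ℚ).IsGloballyMinimal := hb ▸ isGloballyMinimal_g332073f1
  have hf : (⟨1, (-1), 0, (-933), (-497008)⟩ : WeierstrassCurve ℚ).conductorExponent (natPlace 3) = 3 := by
    have h := Rank2Observatory.Tate.DeepCert.conductorExponent_int_eq (W₀ := (⟨1, (-1), 0, (-933), (-497008)⟩ : WeierstrassCurve ℤ)) (c := ⟨3, 7, 1, 10, 9, 8, 0⟩) (natPlace 3)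
      (natGenerator_natPlace (by norm_num)) hGM (by decide +kernel)
    rw [hb] at h
    exact h.trans (by decide)
  refine ⟨by decide, addv_g332073f1_3, ?_, ?_⟩
  · exact not_lt.mpr (padicValRat_j_nonneg_of_intModel hI 3 (a := 4) (b := 9) (by decide +kernel) (by decide +kernel) (by norm_num))
  · show ¬ ((⟨1, (-1), 0, (-933), (-497008)⟩ : WeierstrassCurve ℚ).conductorExponent (placeOf 3) = 2)
    rw [← natPlace_eq_placeOf, hf]; decide

/-- `Δ(332073f1) = (-47439)³` — a CUBE (kernel, `norm_num`). [cite: Serre1972, §5.3] [cite: Cremona2006, Table 1 (Cremona label 332073f1)] -/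
theorem Δ_eq_cube_g332073f1 : (⟨1, (-1), 0, (-933), (-497008)⟩ : WeierstrassCurve ℚ).Δ = (((-47439) : ℚ)) ^ 3 := by
  norm_num [WeierstrassCurve.Δ, WeierstrassCurve.b₂, WeierstrassCurve.b₄, WeierstrassCurve.b₆, WeierstrassCurve.b₈]

/-- **`ρ̄_{332073f1,3}` is NOT surjective** (kernel): `Δ` is a cube, tree THEOREM `ModThreeImage.not_hasSurjectiveModNGaloisRep_three_of_Δ_eq_cube`
(Serre 1972 §5.3: `ℚ(E[3]) ⊇ ℚ(μ₃, ∛Δ)`). [cite: Serre1972, §5.3] [cite: Cremona2006, Table 1 (Cremona label 332073f1)] -/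
theorem notSurjThree_g332073f1 : ¬ (⟨1, (-1), 0, (-933), (-497008)⟩ : WeierstrassCurve ℚ).HasSurjectiveModNGaloisRep 3 := by
  haveI := isElliptic_g332073f1
  exact ModThreeImage.not_hasSurjectiveModNGaloisRep_three_of_Δ_eq_cube (⟨1, (-1), 0, (-933), (-497008)⟩ : WeierstrassCurve ℚ) (d := ((-47439) : ℚ)) Δ_eq_cube_g332073f1

/-- **(A) AT `(332073f1, 3)` FROM ONE CLASSICAL `μ`-HYPOTHESIS, image `3Nn` DISPLAYED** — the conclusion of the K9 crux
`WildCoatesSujathaResidue` (item 19942) AT THIS ROW, from Coates–Sujatha Thm. 3.4 (`hCS`), Iwasawa's growth theorem (`hI`), Ferrero–Washington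
(`hFW`) — named facts —, the image EQUALITY `HasModPImageEqNonsplitCartanNormalizer E 3` (`himg`, LMFDB `3Nn`; only `ρ̄₃` not onto is
certified here, `notSurjThree_g332073f1`) and `μ = 0` for every cyclotomic `ℤ_3`-extension of the maximal real subfield `ℚ(E[3])⁺ = ℚ(P)`
(degree `8`), `c` any complex conjugation. CONDITIONAL; nothing booked; (A)/BSD proved for no curve.
[cite: CoatesSujatha2005, Thm. 3.4 (§3)] [cite: Serre1972, §2.2, §5.2 (iv)] [cite: Washington1997, §13.1] [cite: Cremona2006, Table 1 (Cremona label 332073f1)] -/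
theorem conjA_g332073f1_3
    (hCS : CoatesSujatha2005.thm34_fineSelmerDual_moduleFinite_of_classicalMuVanishes_divisionField)
    (hI : iwasawa1959_classNumberPExp_growth) (hFW : ferreroWashington1979_classicalMuVanishes)
    {W : WeierstrassCurve ℚ} [W.IsElliptic] (hWeq : W = (⟨1, (-1), 0, (-933), (-497008)⟩ : WeierstrassCurve ℚ)) (himg : HasModPImageEqNonsplitCartanNormalizer W 3)
    {c : absoluteGaloisGroup ℚ} (hc : IsComplexConjugation (Rat.castHom ℝ) c)
    (hμ : ∀ κE : ZpExtension ↥(fixedField (Subgroup.zpowers (absRestrictNormalHom (W.divisionField 3) c))) 3,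
      κE.IsCyclotomic → ClassicalMuVanishes κE)
    (κ : ZpExtension ℚ 3) (hκ : κ.IsCyclotomic) :
    ∃ (γ : absoluteGaloisGroup ℚ) (Df : W.FineSelmerDualData κ γ),
      Module.Finite ℤ_[3] (RestrictScalars ℤ_[3] (IwasawaAlgebra 3) Df.X) := by
  subst hWeq
  exact CartanMuRoadRealDoors.conjA_three_of_hasModPImageEqNonsplitCartanNormalizer_of_realMu' _ hCS hI hFW himg hc hμ κ hκ

/-- **RECORD — U₀ `ord₃ #Ш(E) ≤ ord₃ #Ш_an(E)` for `E = 332073f1` (a RESIDUE row of K9 items 19189 / 19197) FROM ONE CLASSICAL `μ`-HYPOTHESIS,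
image `3Nn` DISPLAYED**: named facts `hKatoA hGZK hmod hCS hI hFW`; DISPLAYED: Cremona's `r_an = 0` (`hr`), the image equality (`himg`),
`μ = 0` for the cyclotomic `ℤ_3`-extension of the maximal real subfield of `ℚ(E[3])` (`hμ`). KERNEL: elliptic + minimal, `ClassO6 E 3`,
`E[3]` irreducible. Per row; nothing booked; BSD proved for no curve. [cite: Kato2004Asterisque, Thm. 14.5 (3) (p. 236)]
[cite: CoatesSujatha2005, Thm. 3.4 (§3)] [cite: Washington1997, §13.1] [cite: Cremona2006, Table 1 (Cremona label 332073f1)] -/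
theorem missingUpperBoundAt_g332073f1_3
    (hKatoA : Kato2004.rankZero_padicValNat_sha_add_padicValNat_tamagawa_le_of_additive_potGood_of_irreducible_of_fineSelmerDual_fg)
    (hGZK : rank_eq_analyticRank_of_analyticRank_le_one) (hmod : hasEntireLFunction_rat)
    (hCS : CoatesSujatha2005.thm34_fineSelmerDual_moduleFinite_of_classicalMuVanishes_divisionField)
    (hI : iwasawa1959_classNumberPExp_growth) (hFW : ferreroWashington1979_classicalMuVanishes)
    {W : WeierstrassCurve ℚ} [W.IsElliptic] [W.IsGloballyMinimal] (hWeq : W = (⟨1, (-1), 0, (-933), (-497008)⟩ : WeierstrassCurve ℚ)) (hr : W.analyticRank = 0)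
    (himg : HasModPImageEqNonsplitCartanNormalizer W 3)
    {c : absoluteGaloisGroup ℚ} (hc : IsComplexConjugation (Rat.castHom ℝ) c)
    (hμ : ∀ κE : ZpExtension ↥(fixedField (Subgroup.zpowers (absRestrictNormalHom (W.divisionField 3) c))) 3,
      κE.IsCyclotomic → ClassicalMuVanishes κE) :
    MissingUpperBoundAt W 3 := by
  subst hWeq
  haveI : Fact (Nat.Prime 3) := ⟨Nat.prime_three⟩
  exact CartanMuRoadRealDoors.missingUpperBoundAt_three_of_hasModPImageEqNonsplitCartanNormalizer_of_realMu' _ hKatoA hGZK hmod hCS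
    hI hFW hr classO6_g332073f1_3 irr_g332073f1_3 himg hc hμ

end Summit.BirchSwinnertonDyer.BirchSwinnertonDyer.Theorems.WildUpperUnitTwistRecords

end
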